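import Literature.AnabelianGeometry.AbsoluteAnabelian.AbsTopIProp410TemperedModelRankThree
import Literature.AnabelianGeometry.SemiGraphs.TemperedFibreProduct
import HarnessLib

/-!
# [AbsTopI] Prop 4.10 (iii): the intrinsic residues (CF_Δ) and `hmin` HOLD for the fibre-product
# tempered models `Γ × 1 ≤ (P ×_Z ℤ) × G` (proof-only)

S. Mochizuki, *Topics in Absolute Anabelian Geometry I: Generalities* [AbsTopI] (2012), §0 p. 8
(co-free / minimal co-free subgroups; "every characteristic open subgroup of finite index `H ⊆ Δ`
admits a minimal co-free subgroup `H^{co-fr}`"), §0 p. 9 ("a basis of characteristic open subgroups"),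
Prop 4.10 (i) p. 60 ("`π₁^tp(X)` is naturally isomorphic to its `π₁(X)`-co-free completion" — the
basis clause (CF)); manuscript pagination, lit key `paper:url-11ac98ba15fc`.  [SemiAnbd] Def 3.1 (i)
p. 33 / Ex 3.10 pp. 43–45; [EtTh] §1 p. 12: abc-iut-w5-d218's fibre products `Γ = P ×_Z ℤ`
(`TemperedFibreProduct*.lean`), imitating the tempered fundamental group of a once-punctured Tate
curve (dual graph = one loop).

For `Γ = P ×_Z ℤ` (`P` profinite, `Z` Hausdorff, `pr_ℤ` onto), ANY `T₁` topological group `G`, and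
`Δ := Γ × 1 ≤ Γ × G` (the shape of `Δ^tp = Ker(aug)` in the cell's models `Π^tp := Γ × G_{ℚ_p}`):
* `exists_isMinimalCofreeIn_index` — **`hmin`**: every index `H : CharOpenSubgroup Δ` has the minimal
  co-free subgroup `H ∩ (Γ₀ × 1)`, `Γ₀ = Ker(pr_ℤ)` the compact slice (co-free: open in `H`, quotient
  `↪ ℤ` free; compact ⇒ minimal, `isMinimalCofreeIn_of_isCompact`); `cofreeCore_index_eq`;
* `cofreeCore_cofinal_index` — **(CF_Δ)**: every open normal subgroup of `Δ` contains some
  `H′^{co-fr}` (a slice `(V × 0) ∩ Γ` inside it, a characteristic open `H′ ≤ pr₁⁻¹V × 1` by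
  [AbsTopI] §0 p. 9 = the tree's `CharOpenSubgroup.exists_le`, and `H′^{co-fr} = H′ ∩ (Γ₀ × 1)`);
* the `c ↦ x` projection `π′ : F₃ → F₂` (`a ↦ 1, b ↦ y, c ↦ x`), its section and exponent sums
  (`proj₃'_section`, `ker_proj₃'_le_normalClosure`, `expSum₀_comp_proj₃'`) — bookkeeping for the
  non-compact model `Γ₃ ↠ Γ₂` of `AbsTopIProp410TemperedModelNonVacuity.lean`, whose target fibre
  product is cut out by the exponent sum of the FIRST generator (the convention of w5-d218's slimness
  theorem `TemperedFibreProduct.isSlimGroup`).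
Hypothesis-parametrised, PROOF-ONLY (no `def`, no instance, no named fact; FACT-LIST untouched).
HONEST FRAMING: classical topology/group theory about OUR model groups; refereed prerequisite papers;
nothing here bears on [IUTchIII] Cor 3.12; typed ≠ proved.
-/

noncomputable section

open _root_.Topology _root_.Filter _root_.Set _root_.Function

namespace Literature.AnabelianGeometry.SemiGraphs.TemperedFibreProduct

open Literature.AnabelianGeometry.AbsoluteAnabelian
open Literature.AnabelianGeometry.AbsoluteAnabelian.AbsTopI

universe u v

variable {P : Type u} [Group P] [TopologicalSpace P] [IsTopologicalGroup P] [CompactSpace P]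
  [TotallyDisconnectedSpace P]
variable {Z : Type v} [Group Z] [TopologicalSpace Z] [T2Space Z]
variable (e : P →ₜ* Z) (ι : Multiplicative ℤ →* Z)
variable (Γ : Subgroup (P × Multiplicative ℤ)) (hΓ : ∀ p, p ∈ Γ ↔ e p.1 = ι p.2)
variable {G : Type*} [Group G] [TopologicalSpace G] [IsTopologicalGroup G] [T1Space G]

omit [TotallyDisconnectedSpace P] in
include hΓ in
/-- **`hmin` for the fibre-product models**: every index `H` of `Δ = Γ × 1 ≤ Γ × G` admits the
minimal co-free subgroup `H ∩ (Γ₀ × 1)` (`Γ₀ = Ker(pr_ℤ)` compact): it is open in `H`, normal, with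
quotient embedding in `ℤ` (hence free), and compact. [cite: MochizukiAbsTopI2012, §0 p.8] -/
theorem isMinimalCofreeIn_index {Δ : Subgroup (Γ × G)}
    (hΔ : Δ = (⊤ : Subgroup Γ).prod (⊥ : Subgroup G)) (H : CharOpenSubgroup Δ) :
    IsMinimalCofreeIn H.toSubgroup
      (((((MonoidHom.snd P (Multiplicative ℤ)).comp Γ.subtype).ker).prod (⊥ : Subgroup G)) ⊓
        H.toSubgroup) := by
  classical
  set K : Subgroup Γ := ((MonoidHom.snd P (Multiplicative ℤ)).comp Γ.subtype).ker with hKdef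
  set C : Subgroup (Γ × G) := K.prod (⊥ : Subgroup G) with hCdef
  have hmemΔ : ∀ x : Γ × G, x ∈ Δ ↔ x.2 = 1 := fun x => by rw [hΔ]; simp [Subgroup.mem_prod]
  have hmemC : ∀ x : Γ × G, x ∈ C ↔ (x.1 : P × Multiplicative ℤ).2 = 1 ∧ x.2 = 1 := fun x => by
    rw [hCdef, Subgroup.mem_prod, MonoidHom.mem_ker, Subgroup.mem_bot]; rfl
  haveI : K.Normal := MonoidHom.normal_ker _
  haveI : C.Normal := Subgroup.prod_normal K ⊥
  -- `H` is closed in `Γ × G` (open, hence closed, in the closed `Δ = Γ × 1`)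
  have hΔclosed : IsClosed (Δ : Set (Γ × G)) := by
    have : (Δ : Set (Γ × G)) = Prod.snd ⁻¹' {1} := by ext x; rw [SetLike.mem_coe, hmemΔ]; rfl
    rw [this]; exact isClosed_singleton.preimage continuous_snd
  have hHclosed : IsClosed (H.toSubgroup : Set (Γ × G)) := by
    have heq : (H.toSubgroup : Set (Γ × G)) =
        Subtype.val '' ((H.toSubgroup.subgroupOf Δ : Subgroup Δ) : Set Δ) := by
      ext g
      constructor
      · intro hg; exact ⟨⟨g, H.le hg⟩, Subgroup.mem_subgroupOf.mpr hg, rfl⟩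
      · rintro ⟨x, hx, rfl⟩; exact Subgroup.mem_subgroupOf.mp hx
    have hcl : IsClosed ((H.toSubgroup.subgroupOf Δ : Subgroup Δ) : Set Δ) :=
      Subgroup.isClosed_of_isOpen _ H.isOpen
    rw [heq]
    exact (hΔclosed.isClosedEmbedding_subtypeVal).isClosedMap _ hcl
  -- the candidate `M = C ∩ H` is compact
  have hMc : IsCompact (((C ⊓ H.toSubgroup : Subgroup (Γ × G))) : Set (Γ × G)) := by
    rw [Subgroup.coe_inf, hCdef, Subgroup.coe_prod, Subgroup.coe_bot]
    exact ((isCompact_ker_snd e ι Γ hΓ).prod isCompact_singleton).inter_right hHclosed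
  -- `M` is co-free in `H`
  have hsub : (C ⊓ H.toSubgroup).subgroupOf H.toSubgroup = C.subgroupOf H.toSubgroup :=
    Subgroup.inf_subgroupOf_right C H.toSubgroup
  haveI hn : ((C ⊓ H.toSubgroup).subgroupOf H.toSubgroup).Normal := by rw [hsub]; infer_instance
  let ψ : H.toSubgroup →* Multiplicative ℤ :=
    (((MonoidHom.snd P (Multiplicative ℤ)).comp Γ.subtype).comp (MonoidHom.fst Γ G)).comp
      H.toSubgroup.subtype
  have hψ : ∀ h : H.toSubgroup, ψ h = (((h : Γ × G).1 : Γ) : P × Multiplicative ℤ).2 := fun _ => rfl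
  have hψker : ψ.ker = (C ⊓ H.toSubgroup).subgroupOf H.toSubgroup := by
    rw [hsub]
    ext h
    rw [MonoidHom.mem_ker, hψ, Subgroup.mem_subgroupOf, hmemC]
    exact ⟨fun hh => ⟨hh, (hmemΔ _).1 (H.le h.2)⟩, fun hh => hh.1⟩
  have hopen : IsOpen ((((C ⊓ H.toSubgroup).subgroupOf H.toSubgroup : Subgroup H.toSubgroup)) :
      Set H.toSubgroup) := by
    have hset : ((((C ⊓ H.toSubgroup).subgroupOf H.toSubgroup : Subgroup H.toSubgroup)) :
        Set H.toSubgroup) = (fun h : H.toSubgroup => ((h : Γ × G).1)) ⁻¹' (K : Set Γ) := by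
      ext h
      rw [hsub, SetLike.mem_coe, Subgroup.mem_subgroupOf, hmemC, Set.mem_preimage, SetLike.mem_coe,
        MonoidHom.mem_ker]
      exact ⟨fun hh => hh.1, fun hh => ⟨hh, (hmemΔ _).1 (H.le h.2)⟩⟩
    rw [hset]
    exact (isOpen_ker_snd Γ).preimage (continuous_fst.comp continuous_subtype_val)
  have hfree : IsFreeGroup (H.toSubgroup ⧸ (C ⊓ H.toSubgroup).subgroupOf H.toSubgroup) := by
    haveI : IsFreeGroup (Multiplicative ℤ) :=
      IsFreeGroup.ofMulEquiv (FreeGroup.mulEquivIntOfUnique (α := Unit))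
    haveI : IsFreeGroup ψ.range := subgroupIsFreeOfIsFree ψ.range
    exact IsFreeGroup.ofMulEquiv
      ((QuotientGroup.quotientMulEquivOfEq hψker.symm).trans
        (QuotientGroup.quotientKerEquivRange ψ)).symm
  have hcof : IsCofreeIn H.toSubgroup (C ⊓ H.toSubgroup) := ⟨inf_le_right, hn, ⟨hopen, hfree⟩⟩
  exact isMinimalCofreeIn_of_isCompact hcof hMc

omit [TotallyDisconnectedSpace P] in
include hΓ in
/-- `hmin` in the shape consumed by the node's closers. [cite: MochizukiAbsTopI2012, §0 p.8] -/
theorem exists_isMinimalCofreeIn_index {Δ : Subgroup (Γ × G)}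
    (hΔ : Δ = (⊤ : Subgroup Γ).prod (⊥ : Subgroup G)) (H : CharOpenSubgroup Δ) :
    ∃ M, IsMinimalCofreeIn H.toSubgroup M :=
  ⟨_, isMinimalCofreeIn_index e ι Γ hΓ hΔ H⟩

omit [TotallyDisconnectedSpace P] in
include hΓ in
/-- `H^{co-fr} = (Γ₀ × 1) ∩ H` for every index `H` of `Γ × 1`. [cite: MochizukiAbsTopI2012, §0 p.8] -/
theorem cofreeCore_index_eq {Δ : Subgroup (Γ × G)}
    (hΔ : Δ = (⊤ : Subgroup Γ).prod (⊥ : Subgroup G)) (H : CharOpenSubgroup Δ) :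
    cofreeCore H.toSubgroup =
      ((((MonoidHom.snd P (Multiplicative ℤ)).comp Γ.subtype).ker).prod (⊥ : Subgroup G)) ⊓
        H.toSubgroup :=
  cofreeCore_eq_of_isMinimalCofreeIn (isMinimalCofreeIn_index e ι Γ hΓ hΔ H)

include hΓ in
/-- **(CF_Δ) for the fibre-product models**: every open normal subgroup `N` of `Δ = Γ × 1` contains
the co-free core of some index — a slice `(V × 0) ∩ Γ` lies in `N`, a characteristic open `H′` lies
in `pr₁⁻¹V × 1` ([AbsTopI] §0 p. 9, `CharOpenSubgroup.exists_le`, needs `Δ` topologically finitely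
generated), and `H′^{co-fr} = H′ ∩ (Γ₀ × 1)`. [cite: MochizukiAbsTopI2012, §0 p.9] -/
theorem cofreeCore_cofinal_index {Δ : Subgroup (Γ × G)}
    (hΔ : Δ = (⊤ : Subgroup Γ).prod (⊥ : Subgroup G)) (htfg : IsTopologicallyFinitelyGenerated Δ)
    (N : OpenNormalSubgroup Δ) :
    ∃ H' : CharOpenSubgroup Δ, (cofreeCore H'.toSubgroup).subgroupOf Δ ≤ N.toSubgroup := by
  classical
  let K : Subgroup Γ := ((MonoidHom.snd P (Multiplicative ℤ)).comp Γ.subtype).ker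
  have hmemΔ : ∀ x : Γ × G, x ∈ Δ ↔ x.2 = 1 := fun x => by rw [hΔ]; simp [Subgroup.mem_prod]
  -- the embedding `Γ → Δ`, `γ ↦ (γ, 1)`; `N` pulls back to a neighbourhood of `1`, containing a slice
  let g : Γ → Δ := fun γ => ⟨(γ, 1), (hmemΔ _).2 rfl⟩
  have hg : Continuous g := (continuous_id.prodMk continuous_const).subtype_mk _
  have hgN : g ⁻¹' (N : Set Δ) ∈ 𝓝 (1 : Γ) := by
    refine hg.continuousAt.preimage_mem_nhds ?_
    have h1 : g 1 = 1 := rfl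
    rw [h1]; exact N.isOpen.mem_nhds N.one_mem
  obtain ⟨V, NV, -, hNV, hNVsub⟩ := exists_openNormal_le_of_mem_nhds Γ hgN
  haveI : V.toSubgroup.Normal := V.isNormal'
  -- `U := pr₁⁻¹ V × 1`, open of finite index in `Δ`
  let U : Subgroup (Γ × G) :=
    (V.toSubgroup.comap ((MonoidHom.fst P (Multiplicative ℤ)).comp Γ.subtype)).prod (⊥ : Subgroup G)
  have hmemU : ∀ x : Γ × G, x ∈ U ↔ ((x.1 : Γ) : P × Multiplicative ℤ).1 ∈ V ∧ x.2 = 1 := fun x => by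
    rw [Subgroup.mem_prod, Subgroup.mem_comap, Subgroup.mem_bot]; rfl
  have hUo : IsOpen ((U.subgroupOf Δ : Subgroup Δ) : Set Δ) := by
    have hset : ((U.subgroupOf Δ : Subgroup Δ) : Set Δ) =
        (fun δ : Δ => (((δ : Γ × G).1 : Γ) : P × Multiplicative ℤ).1) ⁻¹' (V : Set P) := by
      ext δ
      rw [SetLike.mem_coe, Subgroup.mem_subgroupOf, hmemU]
      exact ⟨fun h => h.1, fun h => ⟨h, (hmemΔ _).1 δ.2⟩⟩
    rw [hset]
    exact V.isOpen.preimage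
      ((continuous_fst.comp continuous_subtype_val).comp (continuous_fst.comp continuous_subtype_val))
  let θ : Δ →* P ⧸ V.toSubgroup :=
    (QuotientGroup.mk' V.toSubgroup).comp
      ((((MonoidHom.fst P (Multiplicative ℤ)).comp Γ.subtype).comp (MonoidHom.fst Γ G)).comp Δ.subtype)
  have hθker : θ.ker = U.subgroupOf Δ := by
    ext δ
    rw [MonoidHom.mem_ker, Subgroup.mem_subgroupOf, hmemU]
    change ((((((δ : Γ × G).1 : Γ) : P × Multiplicative ℤ).1 : P) : P ⧸ V.toSubgroup)) = 1 ↔ _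
    rw [QuotientGroup.eq_one_iff]
    exact ⟨fun h => ⟨h, (hmemΔ _).1 δ.2⟩, fun h => h.1⟩
  haveI : (U.subgroupOf Δ).FiniteIndex := by
    rw [← hθker]
    refine ⟨fun h0 => ?_⟩
    rw [Subgroup.index_ker] at h0
    haveI : Finite (P ⧸ V.toSubgroup) := inferInstance
    haveI : Finite θ.range := inferInstance
    exact Nat.card_pos.ne' h0
  obtain ⟨H', hH'⟩ := CharOpenSubgroup.exists_le htfg U hUo
  refine ⟨H', fun δ hδ => ?_⟩
  have hδ' : (δ : Γ × G) ∈ cofreeCore H'.toSubgroup := Subgroup.mem_subgroupOf.mp hδ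
  rw [cofreeCore_index_eq e ι Γ hΓ hΔ H'] at hδ'
  obtain ⟨hδC, hδH⟩ := Subgroup.mem_inf.mp hδ'
  obtain ⟨hδK, -⟩ := Subgroup.mem_prod.mp hδC
  have hδU : (δ : Γ × G) ∈ U := hH' hδH
  have hγ : (δ : Γ × G).1 ∈ NV := (hNV _).2 ⟨((hmemU _).1 hδU).1, hδK⟩
  have hgδ : g (δ : Γ × G).1 = δ := Subtype.ext (Prod.ext rfl ((hmemΔ _).1 δ.2).symm)
  have := hNVsub hγ
  rwa [Set.mem_preimage, hgδ] at this

end Literature.AnabelianGeometry.SemiGraphs.TemperedFibreProduct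

/-! ### The projection `F₃ → F₂`, `a ↦ 1`, `b ↦ y`, `c ↦ x` -/

namespace Literature.AnabelianGeometry.AbsoluteAnabelian.AbsTopI.Prop410

/-- `π′ ∘ s′ = id` for `π′ : a ↦ 1, b ↦ y, c ↦ x` and its section `s′ : x ↦ c, y ↦ b`.
[cite: MochizukiAbsTopI2012, Def 4.2 (iii) p.50] -/
theorem proj₃'_section (w : FreeGroup (Fin 2)) :
    FreeGroup.lift ![(1 : FreeGroup (Fin 2)), FreeGroup.of 1, FreeGroup.of 0]
      (FreeGroup.lift ![FreeGroup.of (2 : Fin 3), FreeGroup.of 1] w) = w := by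
  have h : (FreeGroup.lift ![(1 : FreeGroup (Fin 2)), FreeGroup.of 1, FreeGroup.of 0]).comp
      (FreeGroup.lift ![FreeGroup.of (2 : Fin 3), FreeGroup.of 1]) = MonoidHom.id _ :=
    FreeGroup.ext_hom _ _ fun i => match i with
      | 0 => by simp
      | 1 => by simp
  exact DFunLike.congr_fun h w

/-- `Ker π′ ≤ ⟨⟨a⟩⟩` (the quotient map `F₃ → F₃/⟨⟨a⟩⟩` factors through `s′ ∘ π′`).
[cite: MochizukiAbsTopI2012, Def 4.2 (iii) p.50] -/
theorem ker_proj₃'_le_normalClosure :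
    (FreeGroup.lift ![(1 : FreeGroup (Fin 2)), FreeGroup.of 1, FreeGroup.of 0]).ker ≤
      Subgroup.normalClosure ({FreeGroup.of 0} : Set (FreeGroup (Fin 3))) := by
  intro u hu
  let π : FreeGroup (Fin 3) →* FreeGroup (Fin 2) :=
    FreeGroup.lift ![(1 : FreeGroup (Fin 2)), FreeGroup.of 1, FreeGroup.of 0]
  let s : FreeGroup (Fin 2) →* FreeGroup (Fin 3) := FreeGroup.lift ![FreeGroup.of (2 : Fin 3), FreeGroup.of 1]
  let Ncl : Subgroup (FreeGroup (Fin 3)) := Subgroup.normalClosure ({FreeGroup.of 0} : Set _)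
  have hqa : (QuotientGroup.mk' Ncl) (FreeGroup.of 0) = 1 :=
    (QuotientGroup.eq_one_iff _).mpr (Subgroup.subset_normalClosure (Set.mem_singleton _))
  have hhom : QuotientGroup.mk' Ncl = (QuotientGroup.mk' Ncl).comp (s.comp π) := by
    refine FreeGroup.ext_hom _ _ fun i => ?_
    match i with
    | 0 =>
      rw [hqa, MonoidHom.comp_apply, MonoidHom.comp_apply]
      simp [π]
    | 1 => rw [MonoidHom.comp_apply, MonoidHom.comp_apply]; simp [π, s]
    | 2 => rw [MonoidHom.comp_apply, MonoidHom.comp_apply]; simp [π, s]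
  have hπu : π u = 1 := (MonoidHom.mem_ker).mp hu
  have hq : (QuotientGroup.mk' Ncl) u = 1 := by
    rw [hhom, MonoidHom.comp_apply, MonoidHom.comp_apply, hπu, map_one, map_one]
  exact (QuotientGroup.eq_one_iff u).mp hq

/-- The `x`-exponent (first generator of `F₂`) of `π′ u` is the `c`-exponent of `u`.
[cite: MochizukiAbsTopI2012, Def 4.2 (iii) p.50] -/
theorem expSum₀_comp_proj₃' (u : FreeGroup (Fin 3)) :
    (FreeGroup.lift fun j : Fin 2 => if j = 0 then Multiplicative.ofAdd (1 : ℤ) else 1)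
      (FreeGroup.lift ![(1 : FreeGroup (Fin 2)), FreeGroup.of 1, FreeGroup.of 0] u) =
    (FreeGroup.lift fun j : Fin 3 => if j = 2 then Multiplicative.ofAdd (1 : ℤ) else 1) u := by
  have h : (FreeGroup.lift fun j : Fin 2 => if j = 0 then Multiplicative.ofAdd (1 : ℤ) else 1).comp
      (FreeGroup.lift ![(1 : FreeGroup (Fin 2)), FreeGroup.of 1, FreeGroup.of 0]) =
      (FreeGroup.lift fun j : Fin 3 => if j = 2 then Multiplicative.ofAdd (1 : ℤ) else 1) :=
    FreeGroup.ext_hom _ _ fun i => match i with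
      | 0 => by simp
      | 1 => by simp
      | 2 => by simp
  exact DFunLike.congr_fun h u

end Literature.AnabelianGeometry.AbsoluteAnabelian.AbsTopI.Prop410

end
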